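import Literature.MathematicalPhysics.QuantumLattice.HubbardLinkedCluster
import Literature.Analysis.Matrix.DetAddDiagonalMinors

/-!
# The shifted (tadpole-subtracted) time-ordered Wick theorem: `⟨∏ₚ (a⁺ₚa⁻ₚ(τₚ) − dₚ)⟩ = det (G − diagonal d)`

For a quasi-free thermal state of lattice fermions (one-body matrix `h`, inverse temperature `β`),
evolved pairs `Xₚ = e^{τₚ dΓ(h)} c†_{oₚ} c_{o'ₚ} e^{−τₚ dΓ(h)}` (`p = 0, …, n−1`, in this order) and
complex shifts `dₚ`:

* `gibbsState_dGamma_prod_evolved_sub_smul_eq_det` —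
  **`⟨(X₀ − d₀)(X₁ − d₁)⋯(X_{n−1} − d_{n−1})⟩_β = det (G − diagonal d)`**, where
  `G = propMatrix β h o o' τ` is the pair-indexed matrix of time-ordered free propagators of the tree
  (`HubbardLinkedCluster.propMatrix`; Gaudin's rule `⟨X₀⋯X_{n−1}⟩ = det G` is
  `gibbsState_dGamma_prod_evolved_eq_det` at equal pair times).

This is the coefficient identity behind "tadpole subtraction" / Hartree counterterms in fermionic
perturbation theory: the Dyson coefficients of an interaction written with shifted densities
`∏ (n_{x↑} − ν)(n_{x↓} − ν')` are determinants of the propagator matrix with `ν, ν'` subtracted on the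
diagonal (Benfatto–Giuliani–Mastropietro 2006 §2, where the shift is the chemical-potential
counterterm). Ingredients, both elementary and proved here in full generality:

* `listProd_ofFn_add_smul_one_eq_sum` — the NONCOMMUTATIVE binomial expansion of an ordered product
  `∏ᵢ (xᵢ + cᵢ·1)` with central `cᵢ`: a sum over `ε : Fin N → Bool` of `∏_{ε i = false} cᵢ` times the
  ordered product with the factors `xᵢ`, `ε i = true`, kept in place and the others replaced by `1`;
* `listProd_ofFn_ite_one_eq_prod_ofFn_orderEmbOfFin` — dropping the `1`'s: the padded ordered product
  over `S ⊆ Fin N` is the ordered product over `S` enumerated increasingly (`Finset.orderEmbOfFin`);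
* the principal-minor expansion `det (M + diagonal d) = Σ_S (∏_{i∉S} dᵢ) det M|_S`
  (`Literature.Analysis.Matrix.det_add_diagonal_eq_sum_minors`) and `propMatrix_submatrix`.

## References
* M. Gaudin, Nucl. Phys. 15 (1960) 89 (thermal Wick theorem). [cite: Gaudin1960]
* G. Benfatto, A. Giuliani, V. Mastropietro, Ann. Henri Poincaré 7 (2006) 809, §2 (determinant
  representation with counterterms). [cite: BenfattoGiulianiMastropietro2006, §2]
-/

namespace Literature.MathematicalPhysics.QuantumLattice

open Matrix NormedSpace Finset

/-! ### Noncommutative binomial expansion of an ordered product with central shifts -/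

section Expansion

variable {R A : Type*} [CommSemiring R] [Semiring A] [Algebra R A]

/-- **Noncommutative binomial expansion.** In an `R`-algebra `A`, for `x : Fin N → A` and central
shifts `c : Fin N → R`:
`∏ᵢ (xᵢ + cᵢ • 1) = Σ_{ε : Fin N → Bool} (∏_{i, ε i = false} cᵢ) • ∏ᵢ (if ε i then xᵢ else 1)`,
all products ordered (`List.ofFn`). [folklore] -/
theorem listProd_ofFn_add_smul_one_eq_sum :
    ∀ (N : ℕ) (x : Fin N → A) (c : Fin N → R),
      (List.ofFn fun i => x i + c i • (1 : A)).prod =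
        ∑ ε : Fin N → Bool, (∏ i, if ε i then (1 : R) else c i) •
          (List.ofFn fun i => if ε i then x i else (1 : A)).prod
  | 0, x, c => by simp
  | N + 1, x, c => by
    rw [List.ofFn_succ, List.prod_cons,
      listProd_ofFn_add_smul_one_eq_sum N (fun i => x i.succ) (fun i => c i.succ)]
    rw [← (Fin.consEquiv fun _ : Fin (N + 1) => Bool).sum_comp
      (fun ε : Fin (N + 1) → Bool => (∏ i, if ε i then (1 : R) else c i) •
        (List.ofFn fun i => if ε i then x i else (1 : A)).prod)]
    simp only [Fin.consEquiv_apply, Fintype.sum_prod_type, Fintype.sum_bool, Fin.prod_univ_succ,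
      Fin.cons_zero, Fin.cons_succ, List.ofFn_succ, List.prod_cons, if_true, one_mul,
      Bool.false_eq_true, if_false]
    rw [add_mul, Finset.mul_sum, Finset.mul_sum, ← Finset.sum_add_distrib, ← Finset.sum_add_distrib]
    refine Finset.sum_congr rfl fun ε _ => ?_
    simp only [mul_smul_comm, smul_mul_assoc, one_mul, smul_smul, mul_comm (c 0)]

omit [Algebra R A] in
/-- Dropping unit factors from an ordered list product (noncommutative): for a decidable predicate
`p`, `∏_{a ∈ l} (if p a then f a else 1) = ∏_{a ∈ l.filter p} f a`. [folklore] -/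
theorem listProd_map_ite_one_eq_prod_map_filter {α : Type*} (p : α → Prop) [DecidablePred p]
    (f : α → A) (l : List α) :
    (l.map fun a => if p a then f a else 1).prod = ((l.filter p).map f).prod := by
  induction l with
  | nil => simp
  | cons a l ih =>
    by_cases ha : p a
    · simp [ha, ih]
    · simp [ha, ih]

omit [Algebra R A] in
/-- **Dropping the `1`'s of a padded ordered product.** For `S ⊆ Fin N` and `x : Fin N → A`,
`∏_{i < N} (if i ∈ S then xᵢ else 1) = ∏_{k < |S|} x_{e(k)}` with `e = S.orderEmbOfFin rfl` the
increasing enumeration of `S`. [folklore] -/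
theorem listProd_ofFn_ite_one_eq_prod_ofFn_orderEmbOfFin {N : ℕ} (S : Finset (Fin N))
    (x : Fin N → A) :
    (List.ofFn fun i => if i ∈ S then x i else (1 : A)).prod =
      (List.ofFn fun k : Fin S.card => x (S.orderEmbOfFin rfl k)).prod := by
  rw [List.ofFn_eq_map, List.ofFn_eq_map, listProd_map_ite_one_eq_prod_map_filter]
  have h1 : ((List.finRange N).filter (· ∈ S)).SortedLT :=
    ((List.sortedLT_finRange N).pairwise.filter _).sortedLT
  have hsort : (List.finRange N).filter (· ∈ S) = S.sort :=
    h1.eq_of_mem_iff S.sortedLT_sort (fun a => by simp)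
  rw [hsort, ← Finset.listMap_orderEmbOfFin_finRange S rfl, List.map_map]
  rfl

end Expansion

/-! ### The shifted time-ordered Wick theorem -/

section ShiftedWick

variable {ι : Type*} [LinearOrder ι] [Fintype ι]

/-- **Gaudin's rule at equal pair times, in `propMatrix` form.** For Hermitian `h`, real `β`,
orbitals `o, o' : Fin n → ι` and complex pair times `τ`:
`⟨∏ₚ e^{τₚdΓ(h)}c†_{oₚ}e^{−τₚdΓ(h)} · e^{τₚdΓ(h)}c_{o'ₚ}e^{−τₚdΓ(h)}⟩_β = det (propMatrix β h o o' τ)`.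
(`gibbsState_dGamma_prod_evolved_eq_det` with `s = t = τ`.) [cite: Gaudin1960] -/
theorem gibbsState_dGamma_prod_evolved_eq_det_propMatrix {h : Matrix ι ι ℂ} (hh : h.IsHermitian)
    (β : ℝ) {n : ℕ} (o o' : Fin n → ι) (τ : Fin n → ℂ) :
    gibbsState β (dGamma h)
        (List.ofFn fun p : Fin n =>
          (exp (τ p • dGamma h) * creation (o p) * exp (-(τ p • dGamma h))) *
            (exp (τ p • dGamma h) * annihilation (o' p) * exp (-(τ p • dGamma h)))).prod =
      (propMatrix β h o o' τ).det := by
  rw [gibbsState_dGamma_prod_evolved_eq_det hh β o o' τ τ]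
  rfl

/-- **Gaudin's rule for an increasing sub-family of pairs**: the expectation of the ordered product
of the evolved pairs indexed by an order embedding `e : Fin m ↪o Fin n` is the corresponding principal
minor of the propagator matrix. [cite: Gaudin1960] -/
theorem gibbsState_dGamma_prod_evolved_orderEmb_eq_det_submatrix {h : Matrix ι ι ℂ}
    (hh : h.IsHermitian) (β : ℝ) {n m : ℕ} (o o' : Fin n → ι) (τ : Fin n → ℂ) (e : Fin m ↪o Fin n) :
    gibbsState β (dGamma h)
        (List.ofFn fun k : Fin m =>
          (exp (τ (e k) • dGamma h) * creation (o (e k)) * exp (-(τ (e k) • dGamma h))) *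
            (exp (τ (e k) • dGamma h) * annihilation (o' (e k)) * exp (-(τ (e k) • dGamma h)))).prod =
      ((propMatrix β h o o' τ).submatrix e e).det := by
  rw [propMatrix_submatrix]
  exact gibbsState_dGamma_prod_evolved_eq_det_propMatrix hh β (o ∘ e) (o' ∘ e) (τ ∘ e)

/-- **The shifted (tadpole-subtracted) time-ordered Wick theorem.** For Hermitian `h`, real `β`,
orbitals `o, o' : Fin n → ι`, complex pair times `τ` and complex shifts `d : Fin n → ℂ`, with the
evolved pairs `Xₚ = e^{τₚdΓ(h)}c†_{oₚ}e^{−τₚdΓ(h)} · e^{τₚdΓ(h)}c_{o'ₚ}e^{−τₚdΓ(h)}`: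
`⟨(X₀ − d₀·1)(X₁ − d₁·1)⋯(X_{n−1} − d_{n−1}·1)⟩_β = det (propMatrix β h o o' τ − diagonal d)`.
Proof: expand the ordered product over the subsets `S` of kept pairs (noncommutative binomial
expansion, the shifts being central), apply Gaudin's rule to each ordered sub-product (a principal
minor of the propagator matrix, `propMatrix_submatrix`), and resum with the principal-minor expansion
of `det (G + diagonal (−d))`. BGM 2006 §2 (counterterm `ν` on the diagonal of the fermionic
determinant). [cite: BenfattoGiulianiMastropietro2006, §2] -/
theorem gibbsState_dGamma_prod_evolved_sub_smul_eq_det {h : Matrix ι ι ℂ} (hh : h.IsHermitian)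
    (β : ℝ) {n : ℕ} (o o' : Fin n → ι) (τ : Fin n → ℂ) (d : Fin n → ℂ) :
    gibbsState β (dGamma h)
        (List.ofFn fun p : Fin n =>
          (exp (τ p • dGamma h) * creation (o p) * exp (-(τ p • dGamma h))) *
              (exp (τ p • dGamma h) * annihilation (o' p) * exp (-(τ p • dGamma h))) -
            d p • (1 : Matrix (Finset ι) (Finset ι) ℂ)).prod =
      (propMatrix β h o o' τ - Matrix.diagonal d).det := by
  -- the evolved pairs
  set X : Fin n → Matrix (Finset ι) (Finset ι) ℂ := fun p =>
    (exp (τ p • dGamma h) * creation (o p) * exp (-(τ p • dGamma h))) *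
      (exp (τ p • dGamma h) * annihilation (o' p) * exp (-(τ p • dGamma h))) with hX
  -- LHS: noncommutative binomial expansion with the central shifts `-d p`
  have hsub : (fun p : Fin n => X p - d p • (1 : Matrix (Finset ι) (Finset ι) ℂ)) =
      fun p => X p + (-d p) • (1 : Matrix (Finset ι) (Finset ι) ℂ) := by
    funext p; rw [neg_smul, sub_eq_add_neg]
  rw [hsub, listProd_ofFn_add_smul_one_eq_sum, map_sum]
  -- RHS: principal-minor expansion of the diagonal shift
  have hdiag : propMatrix β h o o' τ - Matrix.diagonal d =
      propMatrix β h o o' τ + Matrix.diagonal (fun p => -d p) := by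
    ext a b
    simp only [Matrix.sub_apply, Matrix.add_apply, Matrix.diagonal_apply]
    split_ifs <;> ring
  rw [hdiag, Literature.Analysis.Matrix.det_add_diagonal_eq_sum_minors]
  -- reindex the Boolean sum by the set of kept pairs
  rw [← (⟨fun S : Finset (Fin n) => fun i => decide (i ∈ S), fun ε => Finset.univ.filter fun i => ε i = true,
    fun S => by ext i; simp, fun ε => by funext i; simp⟩ : Finset (Fin n) ≃ (Fin n → Bool)).sum_comp]
  refine Finset.sum_congr rfl fun S _ => ?_
  simp only [Equiv.coe_fn_mk, decide_eq_true_eq, map_smul, smul_eq_mul]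
  congr 1
  · -- the coefficient `∏_{i ∉ S} (-d i)`
    rw [Finset.prod_ite, Finset.prod_const_one, one_mul]
    refine Finset.prod_congr ?_ fun _ _ => rfl
    ext i
    simp [Finset.mem_compl]
  · -- the padded ordered product is the ordered product over `S`; Gaudin's rule gives its minor
    rw [listProd_ofFn_ite_one_eq_prod_ofFn_orderEmbOfFin S X]
    simp only [hX]
    rw [gibbsState_dGamma_prod_evolved_orderEmb_eq_det_submatrix hh β o o' τ (S.orderEmbOfFin rfl)]
    -- `Fin |S| ≃o S`: the two principal minors agree
    have hre : (propMatrix β h o o' τ).submatrix (S.orderEmbOfFin rfl) (S.orderEmbOfFin rfl) =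
        ((propMatrix β h o o' τ).submatrix ((↑) : S → Fin n) ((↑) : S → Fin n)).submatrix
          (S.orderIsoOfFin rfl).toEquiv (S.orderIsoOfFin rfl).toEquiv := by
      ext a b
      rfl
    rw [hre, Matrix.det_submatrix_equiv_self]

end ShiftedWick

end Literature.MathematicalPhysics.QuantumLattice
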